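import Summits.CriticalPhenomena.Ising3DConformalLimit.Theorems.HyperoctahedralRPExistsScaleCovariantLimitFoldedCurrentUniqueness
import HarnessLib

/-!
# Standalone split glue — crux `ExistsScaleCovariantLimit` (item stmt-CriticalPhenomena-1981) ⟸ item 6150 ∧ item 4659, HyperoctahedralRP copy

READY-TO-LAND helper (crux-strategist s1, instance ModularQuarterTurn; Theorems/ is prover-only). Purpose: a CURRIED glue theorem
`TwoPointDoubling → ClusterSetTotallyDisconnected → ExistsScaleCovariantLimit` living in a module that imports NO route file other than those already in
the import cone of `Theorems/HyperoctahedralRPExistsScaleCovariantLimitFoldedCurrentUniqueness.lean` (p139907). The gate writes split glue INTO the route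
file (`theorem <Glue> : C₁ → C₂ → C := <glue-by decl>`), and a glue-by decl is refused `glue.cyclic-import` when its module imports that route file —
which is why `PositivityBegetsConformalityMaps.crux_of_doubling_of_totallyDisconnected` (p144658, imports `Theses.PositivityBegetsConformality`) cannot glue
route PositivityBegetsConformality's own split, while it CAN glue every other route's (their copies of the three decls have the same bodies; accepted by
δ-unfolding — mock `glueprobe2-instMQT.lean`, rc 0). This file gives the same service from the HyperoctahedralRP side: usable via
`ledger route edit <route> --(re)split ExistsScaleCovariantLimit --into children.json --glue-by
Summit.CriticalPhenomena.Ising3DConformalLimit.Cruxes.ExistsScaleCovariantLimit.SplitGlue.hrp_crux_of_doubling_of_totallyDisconnected`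
on every route whose Theses file is NOT in this module's import closure (probe `glueprobe3-instMQT.lean`: PositivityBegetsConformality, PlanarCornerRotations,
TauBallRounding, ModularBoosts, ModularQuarterTurn, HarmonicMomentsIsotropy, MarkovRigidity, ConformalPoissonDevice, UnitLightCone, OrthogonalFrameTP2,
ArmHyperscaling, VolterraWard, GaussianScaleMixture are outside; HyperoctahedralRP, MirrorHoelderCompactness, ClusterRigidity, MonotoneRG are inside).
Land: `ledger propose --kind proof --target Summits/CriticalPhenomena/Ising3DConformalLimit/Theorems/HyperoctahedralRPExistsScaleCovariantLimitSplitGlue.lean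
--file <this> --supports stmt-CriticalPhenomena-1981` (register the sub-goal name first: `ledger workitem stub-add stmt-CriticalPhenomena-1981 --name
hrp_crux_of_doubling_of_totallyDisconnected --signature '<the type below>'`). No `sorry`, no definitions. [folklore]
-/

noncomputable section

namespace Summit.CriticalPhenomena.Ising3DConformalLimit.Cruxes.ExistsScaleCovariantLimit.SplitGlue

open Summit.CriticalPhenomena.Ising3DConformalLimit.Theses
open Summit.CriticalPhenomena.Ising3DConformalLimit.Cruxes.ExistsScaleCovariantLimit.FoldedCurrentRepulsion
  (crux_iff_doubling_and_totallyDisconnected)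

/-- **Curried split glue, HyperoctahedralRP copy**: item 6150 `TwoPointDoubling` and item 4659 `ClusterSetTotallyDisconnected` imply the crux
`ExistsScaleCovariantLimit` (one line from `crux_iff_doubling_and_totallyDisconnected`, p139907). [folklore] -/
theorem hrp_crux_of_doubling_of_totallyDisconnected :
    MirrorHoelderCompactness.TwoPointDoubling → ClusterRigidity.ClusterSetTotallyDisconnected →
      HyperoctahedralRP.ExistsScaleCovariantLimit :=
  fun hD hTD => crux_iff_doubling_and_totallyDisconnected.2 ⟨hD, hTD⟩

/-- Exactness, HyperoctahedralRP copy (re-export of p139907 under the glue namespace). [folklore] -/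
theorem hrp_crux_iff_doubling_and_totallyDisconnected :
    HyperoctahedralRP.ExistsScaleCovariantLimit ↔
      MirrorHoelderCompactness.TwoPointDoubling ∧ ClusterRigidity.ClusterSetTotallyDisconnected :=
  crux_iff_doubling_and_totallyDisconnected

end Summit.CriticalPhenomena.Ising3DConformalLimit.Cruxes.ExistsScaleCovariantLimit.SplitGlue

end
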